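import Summits.QuantumFields.YangMills.Theorems.BalabanUVNodesN07Thm1CornerLevelZeroObstruction
import Summits.QuantumFields.YangMills.Theorems.BalabanUVNodesK0VariationalThm1DatumCoupling
import Literature.MathematicalPhysics.QuantumFieldTheory.Balaban1983to89.Node00.Record12BgRowCoClass
import Literature.MathematicalPhysics.QuantumFieldTheory.Balaban1983to89.T3DescentFibreTower
import Literature.MathematicalPhysics.QuantumFieldTheory.Balaban1983to89.B10StarCount
import Literature.MathematicalPhysics.QuantumFieldTheory.Balaban1983to89.TorusGeometry
import Literature.MathematicalPhysics.QuantumFieldTheory.Balaban1983to89.TorusHypercubicSymmetry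

/-!
# BalabanUVNodes ∕ N07 ([Balaban1985Variational] Thm 1 (7)–(8), node00-def-P11's typed readings FILE 8 §7 ∕ FILE 9 ∕ FILE 10) — GEOMETRY FOR THE FACE DATUM:
# coarse-site bookkeeping on `T⁽¹⁾`, the blocks `B(0)`, `B(e_κ)` inside the `𝐃₁`-cube of side `2L`, and the co-divergence (1.9) bounded by plaquettes

Cell `pub-ymgap`, seat `pub-ymgap-dag-n07-e` generation 8 (R141 (C), DAG node N07 = [15]; ROW P11 negative side, this seat's LOCATED-M4 «free δ₀»,
INBOX l.17944, INTENT-C′ l.18065, INTENT-20c).  Part A1 of the kernel certificate of M4 (A2 = `…N07FaceDatumAverage`, B = `…N07Thm1FreeLevelZeroObstruction`).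
`--kind proof --supports stmt-QuantumFields-20289 --as helper`.  THEOREMS ONLY (0 `def`, 0 `sorry`, 0 `instance`).

WHAT THIS FILE DOES (torus `P`, levels `0 → 1`, standing range `1 ≤ m + K`, `3 ≤ |T⁽¹⁾|` per direction).
* §1 coarse-site bookkeeping on `T⁽¹⁾` (`e_κ ≠ 0`, `e_κ + e_κ′ ≠ 0`, `e_κ + e_κ′ ≠ e_μ`, `−e_κ ≠ e_μ`, `−e_κ + e_κ′ ≠ e_μ`, …; `ZMod` with at least three sites per
  direction) — the block-adjacency facts that make the face datum's window analysis a finite case split.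
* §2 a fine site whose block label has coordinates `≤ 1` lies in `cubeEnl P (2L) 0 0`; hence `B(0)`, `B(e_κ)` and their centres `emb 0`, `emb e_κ` do.
* §3 the (1.9) co-divergence of def-P11's FILE 9 is bounded by the plaquette deviations: `‖η·(D^{η*}_U∂U)(b)‖ ≤ d·(2·max_q |U(∂q) − 1|)` — one term of (1.2) is
  `R(U)(∂U)(p′) − (∂U)(p)` with `|R(U)X − 1| = |X − 1|` (unitary conjugation).

HONEST FRAMING: kernel bookkeeping about the TREE's lattice and def-P11's typed co-divergence; nothing of Bałaban asserted or refuted; N07 ∕ K0⁗ NOT discharged;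
counts unmoved (5∕27); one finite T⁴ programme at fixed ε — NOT continuum ∕ ℝ⁴ ∕ OS ∕ mass gap ∕ Clay.

DEPENDENCES (by name): `Setup.(blockOf, emb, Site.shift∕unshift)`, `TorusGeometry.Site.(blockOf_emb, val_blockOf)`, `TorusHypercubicSymmetry.Site.(shift_apply,
unshift_apply)`, `Node00.(cubeEnl_zero_eq, boxLo, boxHi)`, `T4AxialGaugeSmallField.castSite(_apply)`, def-P11 FILE 9 `Sect2.(coDivSum, coDivTerm, plaqMat)`, r11 `coe_ιSU`.
-/

noncomputable section

namespace Summit.QuantumFields.YangMills.BalabanUVNodes.N07FaceDatumAverage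

open Literature.MathematicalPhysics.QuantumFieldTheory.Balaban1983to89
open Literature.MathematicalPhysics.QuantumFieldTheory.Balaban1983to89.T4Continuum (T4Family)
open Literature.MathematicalPhysics.QuantumFieldTheory.Balaban1983to89.Node00
open Literature.MathematicalPhysics.QuantumFieldTheory.Balaban1983to89.B15DeterminingSets
open Literature.MathematicalPhysics.QuantumFieldTheory.Balaban1983to89.T4AxialGaugeSmallField (castSite castSite_apply)
open scoped Matrix.Norms.L2Operator

/-! ## §1  Coarse-site bookkeeping on `T⁽¹⁾` (at least three sites per direction) -/

section Coarse

variable {P : Params}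

/-- `1 ≠ 0` in `ZMod n` for `n ≥ 3`. [folklore] -/
theorem one_ne_zero_zmod {n : ℕ} (hn : 3 ≤ n) : (1 : ZMod n) ≠ 0 := by
  intro h
  have h2 := (ZMod.natCast_eq_zero_iff 1 n).mp (by exact_mod_cast h)
  have := Nat.le_of_dvd one_pos h2
  omega

/-- `2 ≠ 0` in `ZMod n` for `n ≥ 3`. [folklore] -/
theorem two_ne_zero_zmod {n : ℕ} (hn : 3 ≤ n) : (2 : ZMod n) ≠ 0 := by
  intro h
  have h2 := (ZMod.natCast_eq_zero_iff 2 n).mp (by exact_mod_cast h)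
  have := Nat.le_of_dvd two_pos h2
  omega

/-- `−1 ≠ 0` in `ZMod n` for `n ≥ 3`. [folklore] -/
theorem neg_one_ne_zero_zmod {n : ℕ} (hn : 3 ≤ n) : (-1 : ZMod n) ≠ 0 :=
  neg_ne_zero.mpr (one_ne_zero_zmod hn)

/-- `−1 ≠ 1` in `ZMod n` for `n ≥ 3`. [folklore] -/
theorem neg_one_ne_one_zmod {n : ℕ} (hn : 3 ≤ n) : (-1 : ZMod n) ≠ 1 := by
  intro h
  have : (2 : ZMod n) = 0 := by linear_combination -h
  exact two_ne_zero_zmod hn this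

/-- The coordinates of `0 ∈ T⁽¹⁾` vanish. [folklore] -/
theorem site_zero_apply (i : Fin P.d) : (0 : Site P 1) i = 0 := rfl

/-- The coordinates of the coarse unit point `e_κ = 0 + e_κ`. [folklore] -/
theorem shift_zero_apply (κ i : Fin P.d) : ((0 : Site P 1).shift κ) i = if i = κ then 1 else 0 := by
  rw [Site.shift_apply, site_zero_apply, site_zero_apply, zero_add]

/-- The coordinates of `−e_κ = 0 − e_κ`. [folklore] -/
theorem unshift_zero_apply (κ i : Fin P.d) : ((0 : Site P 1).unshift κ) i = if i = κ then -1 else 0 := by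
  rw [Site.unshift_apply, site_zero_apply, site_zero_apply, zero_sub]

variable (hn : 3 ≤ P.sitesPerDir 1)
include hn

/-- `e_κ ≠ 0`. [folklore] -/
theorem shift_zero_ne_zero (κ : Fin P.d) : (0 : Site P 1).shift κ ≠ 0 := by
  intro h
  have h1 := congrFun h κ
  rw [shift_zero_apply, if_pos rfl, site_zero_apply] at h1
  exact one_ne_zero_zmod hn h1

/-- `e_κ = e_κ′ ⇒ κ = κ′`. [folklore] -/
theorem shift_zero_inj {κ κ' : Fin P.d} (h : (0 : Site P 1).shift κ = (0 : Site P 1).shift κ') : κ = κ' := by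
  by_contra hne
  have h1 := congrFun h κ
  rw [shift_zero_apply, shift_zero_apply, if_pos rfl, if_neg hne] at h1
  exact one_ne_zero_zmod hn h1

/-- `e_κ + e_κ′ ≠ 0`. [folklore] -/
theorem shift_shift_zero_ne_zero (κ κ' : Fin P.d) : ((0 : Site P 1).shift κ).shift κ' ≠ 0 := by
  intro h
  have h1 := congrFun h κ
  rw [Site.shift_apply, shift_zero_apply, shift_zero_apply, if_pos rfl, site_zero_apply] at h1
  by_cases hk : κ = κ'
  · subst hk
    rw [if_pos rfl, if_pos rfl] at h1
    exact two_ne_zero_zmod hn (by linear_combination h1)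
  · rw [if_neg hk] at h1
    exact one_ne_zero_zmod hn h1

/-- `e_κ + e_κ′ ≠ e_μ` (three sites per direction). [folklore] -/
theorem shift_shift_zero_ne_shift (κ κ' μ : Fin P.d) : ((0 : Site P 1).shift κ).shift κ' ≠ (0 : Site P 1).shift μ := by
  intro h
  by_cases hκ'μ : κ' = μ
  · subst hκ'μ
    have h1 := congrFun h κ'
    rw [Site.shift_apply, if_pos rfl, shift_zero_apply, shift_zero_apply, if_pos rfl] at h1
    by_cases hκ : κ' = κ
    · subst hκ
      rw [if_pos rfl] at h1
      exact one_ne_zero_zmod hn (by linear_combination h1)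
    · -- coordinate `κ`: `1 = 0`
      have h2 := congrFun h κ
      rw [Site.shift_apply, if_neg (Ne.symm hκ), shift_zero_apply, if_pos rfl, shift_zero_apply, if_neg (Ne.symm hκ)] at h2
      exact one_ne_zero_zmod hn h2
  · have h1 := congrFun h κ'
    rw [Site.shift_apply, if_pos rfl, shift_zero_apply, shift_zero_apply, if_neg hκ'μ] at h1
    by_cases hκ : κ' = κ
    · rw [if_pos hκ] at h1
      exact two_ne_zero_zmod hn (by linear_combination h1)
    · rw [if_neg hκ, zero_add] at h1
      exact one_ne_zero_zmod hn h1

/-- `−e_κ ≠ e_μ`. [folklore] -/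
theorem unshift_zero_ne_shift (κ μ : Fin P.d) : (0 : Site P 1).unshift κ ≠ (0 : Site P 1).shift μ := by
  intro h
  have h1 := congrFun h μ
  rw [unshift_zero_apply, shift_zero_apply, if_pos rfl] at h1
  by_cases hμ : μ = κ
  · rw [if_pos hμ] at h1; exact neg_one_ne_one_zmod hn h1
  · rw [if_neg hμ] at h1; exact one_ne_zero_zmod hn h1.symm

/-- `−e_κ ≠ 0`. [folklore] -/
theorem unshift_zero_ne_zero (κ : Fin P.d) : (0 : Site P 1).unshift κ ≠ 0 := by
  intro h
  have h1 := congrFun h κ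
  rw [unshift_zero_apply, if_pos rfl, site_zero_apply] at h1
  exact neg_one_ne_zero_zmod hn h1

/-- `−e_κ + e_κ′ ≠ e_μ` (three sites per direction). [folklore] -/
theorem unshift_zero_shift_ne_shift (κ κ' μ : Fin P.d) : ((0 : Site P 1).unshift κ).shift κ' ≠ (0 : Site P 1).shift μ := by
  intro h
  have hμ := congrFun h μ
  rw [Site.shift_apply, unshift_zero_apply, unshift_zero_apply, shift_zero_apply, if_pos rfl] at hμ
  by_cases h1 : μ = κ'
  · subst h1
    rw [if_pos rfl] at hμ
    by_cases h2 : μ = κ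
    · rw [if_pos h2] at hμ
      exact one_ne_zero_zmod hn (by linear_combination -hμ)
    · -- `μ = κ′ ≠ κ`: coordinate `κ` reads `−1 = 0`
      have hκ := congrFun h κ
      rw [Site.shift_apply, if_neg (Ne.symm h2), unshift_zero_apply, if_pos rfl, shift_zero_apply, if_neg (Ne.symm h2)] at hκ
      exact neg_one_ne_zero_zmod hn hκ
  · rw [if_neg h1] at hμ
    by_cases h2 : μ = κ
    · rw [if_pos h2] at hμ; exact neg_one_ne_one_zmod hn hμ
    · rw [if_neg h2] at hμ; exact one_ne_zero_zmod hn hμ.symm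

/-- The `μ₀`-coordinate of `e_{μ₀} + e_κ` is not `0`. [folklore] -/
theorem shift_shift_zero_apply_ne_zero (μ0 κ : Fin P.d) : (((0 : Site P 1).shift μ0).shift κ) μ0 ≠ 0 := by
  rw [Site.shift_apply, shift_zero_apply, shift_zero_apply, if_pos rfl]
  by_cases h : μ0 = κ
  · rw [if_pos h, if_pos h.symm]
    exact fun h' => two_ne_zero_zmod hn (by linear_combination h')
  · rw [if_neg h]
    exact one_ne_zero_zmod hn

end Coarse

/-! ## §2  The blocks `B(0)`, `B(e_κ)` and their centres lie in the `𝐃₁`-cube of side `2L` at the origin -/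

section Cube

variable {P : Params}

/-- A fine site whose block label has all coordinates `≤ 1` lies in `cubeEnl P (2L) 0 0 = [0, 2L − 1]^d` (standing range). [cite: Balaban1987RG1, (0.1) p.252 (bookkeeping)] -/
theorem mem_cubeEnl_two_mul_of_val_blockOf_le (hj : 0 + 1 ≤ P.m + P.K) {x : Site P 0} (hx : ∀ i, ((blockOf x) i).val ≤ 1) :
    x ∈ cubeEnl P (2 * P.L) 0 0 := by
  rw [cubeEnl_zero_eq]
  refine ⟨fun i => ((x i).val : ℤ), ⟨fun i => ?_, fun i => ?_⟩, ?_⟩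
  · simp only [boxLo, Pi.zero_apply, mul_zero]
    positivity
  · simp only [boxHi, Pi.zero_apply, mul_zero, zero_add]
    have h1 := hx i
    rw [Site.val_blockOf hj] at h1
    have hL := P.L_pos
    have hlt : (x i).val < 2 * P.L := by
      by_contra hge
      rw [not_lt] at hge
      have : 2 ≤ (x i).val / P.L := (Nat.le_div_iff_mul_le hL).mpr hge
      omega
    have : ((x i).val : ℤ) < 2 * (P.L : ℤ) := by exact_mod_cast hlt
    push_cast
    linarith
  · funext i
    rw [castSite_apply]
    push_cast
    exact ZMod.natCast_zmod_val (x i)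

/-- The coordinates of `0 ∈ T⁽¹⁾` and of `e_κ` are `≤ 1` (three sites per direction, so `1` does not wrap). [folklore] -/
theorem val_shift_zero_le (hn : 3 ≤ P.sitesPerDir 1) (κ i : Fin P.d) : (((0 : Site P 1).shift κ) i).val ≤ 1 := by
  rw [shift_zero_apply]
  split_ifs
  · haveI : Fact (1 < P.sitesPerDir 1) := ⟨by omega⟩
    rw [ZMod.val_one]
  · rw [ZMod.val_zero]; exact zero_le_one

/-- `B(0) ⊆ cubeEnl P (2L) 0 0`. [cite: Balaban1987RG1, (0.1) p.252 (bookkeeping)] -/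
theorem mem_cubeEnl_of_blockOf_eq_zero (hj : 0 + 1 ≤ P.m + P.K) {x : Site P 0} (hx : blockOf x = 0) : x ∈ cubeEnl P (2 * P.L) 0 0 :=
  mem_cubeEnl_two_mul_of_val_blockOf_le hj fun i => by rw [hx, site_zero_apply, ZMod.val_zero]; exact zero_le_one

/-- `B(e_κ) ⊆ cubeEnl P (2L) 0 0`. [cite: Balaban1987RG1, (0.1) p.252 (bookkeeping)] -/
theorem mem_cubeEnl_of_blockOf_eq_shift (hj : 0 + 1 ≤ P.m + P.K) (hn : 3 ≤ P.sitesPerDir 1) {κ : Fin P.d} {x : Site P 0}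
    (hx : blockOf x = (0 : Site P 1).shift κ) : x ∈ cubeEnl P (2 * P.L) 0 0 :=
  mem_cubeEnl_two_mul_of_val_blockOf_le hj fun i => by rw [hx]; exact val_shift_zero_le hn κ i

/-- The centre of `B(0)` lies in the cube: `0 ∈ pts 1 (cubeEnl P (2L) 0 0)`. [cite: Balaban1987RG1, (0.1) p.252 (bookkeeping)] -/
theorem emb_zero_mem_cubeEnl_two_mul (hj : 0 + 1 ≤ P.m + P.K) : emb (0 : Site P 1) ∈ cubeEnl P (2 * P.L) 0 0 :=
  mem_cubeEnl_of_blockOf_eq_zero hj (Site.blockOf_emb hj 0)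

/-- The centre of `B(e_κ)` lies in the cube: `e_κ ∈ pts 1 (cubeEnl P (2L) 0 0)`. [cite: Balaban1987RG1, (0.1) p.252 (bookkeeping)] -/
theorem emb_shift_zero_mem_cubeEnl_two_mul (hj : 0 + 1 ≤ P.m + P.K) (hn : 3 ≤ P.sitesPerDir 1) (κ : Fin P.d) :
    emb ((0 : Site P 1).shift κ) ∈ cubeEnl P (2 * P.L) 0 0 :=
  mem_cubeEnl_of_blockOf_eq_shift hj hn (Site.blockOf_emb hj _)

end Cube

/-! ## §3  The co-divergence (1.9) is bounded by the plaquette deviations -/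

section CoDiv

variable {P : Params} {j : ℕ} {N : ℕ} [NeZero N]

/-- One term of (1.2): `‖R(U(x,x−e_ν))(∂U)(p(x−e_ν)) − (∂U)(p(x))‖ ≤ |U(∂p(x−e_ν)) − 1| + |U(∂p(x)) − 1| ≤ 2m` (unitary conjugation preserves
`|· − 1|`). [cite: Balaban1985RegularSpaces, (1.1)–(1.2) p.76 (bookkeeping)] -/
theorem norm_coDivTerm_le (U : GaugeField P j (SU N)) {m : ℝ} (hm : ∀ q, dist1 (GaugeField.plaqHol U q) ≤ m) (x : Site P j)
    (ν α β : Fin P.d) (hαβ : α < β) : ‖Sect2.coDivTerm U x ν α β hαβ‖ ≤ 2 * m := by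
  unfold Sect2.coDivTerm Sect2.plaqMat
  simp only [coe_ιSU]
  set g : SU N := U ⟨x.unshift ν, ν⟩ with hg
  set q₁ : SU N := GaugeField.plaqHol U ⟨x.unshift ν, α, β, hαβ⟩ with hq₁
  set q₂ : SU N := GaugeField.plaqHol U ⟨x, α, β, hαβ⟩ with hq₂
  have hA : ((g⁻¹ : SU N) : MatA N) * (q₁ : MatA N) * (g : MatA N) = ((g⁻¹ * q₁ * g : SU N) : MatA N) := rfl
  rw [hA]
  calc ‖((g⁻¹ * q₁ * g : SU N) : MatA N) - (q₂ : MatA N)‖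
      ≤ ‖((g⁻¹ * q₁ * g : SU N) : MatA N) - 1‖ + ‖(1 : MatA N) - (q₂ : MatA N)‖ := norm_sub_le_norm_sub_add_norm_sub _ _ _
    _ = dist1 (g⁻¹ * q₁ * g) + dist1 q₂ := by rw [norm_sub_rev (1 : MatA N)]; rfl
    _ = dist1 q₁ + dist1 q₂ := by
        rw [show g⁻¹ * q₁ * g = g⁻¹ * q₁ * (g⁻¹)⁻¹ by rw [inv_inv], GaugeGroup.dist1_conj]
    _ ≤ m + m := add_le_add (hm _) (hm _)
    _ = 2 * m := by ring

/-- **★ `‖η·(D^{η*}_U ∂U)(b)‖ ≤ d·(2m)` WHEN EVERY PLAQUETTE OF `U` IS WITHIN `m` OF `1`** (def-P11's `Sect2.coDivSum`: a sum over the `d` directions of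
terms of norm `≤ 2m` or `0`). [cite: Balaban1985RegularSpaces, (1.1)–(1.2) p.76, (1.9) p.77 (bookkeeping)] -/
theorem norm_coDivSum_le (U : GaugeField P j (SU N)) {m : ℝ} (hm0 : 0 ≤ m) (hm : ∀ q, dist1 (GaugeField.plaqHol U q) ≤ m) (x : Site P j)
    (μ : Fin P.d) : ‖Sect2.coDivSum U x μ‖ ≤ P.d * (2 * m) := by
  unfold Sect2.coDivSum
  calc ‖∑ ν : Fin P.d, (if h : ν < μ then Sect2.coDivTerm U x ν ν μ h
          else if h' : μ < ν then -Sect2.coDivTerm U x ν μ ν h' else 0)‖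
      ≤ ∑ ν : Fin P.d, ‖(if h : ν < μ then Sect2.coDivTerm U x ν ν μ h
          else if h' : μ < ν then -Sect2.coDivTerm U x ν μ ν h' else 0)‖ := norm_sum_le _ _
    _ ≤ ∑ _ν : Fin P.d, 2 * m := Finset.sum_le_sum fun ν _ => by
        by_cases h1 : ν < μ
        · rw [dif_pos h1]; exact norm_coDivTerm_le U hm x ν ν μ h1
        · rw [dif_neg h1]
          by_cases h2 : μ < ν
          · rw [dif_pos h2, norm_neg]; exact norm_coDivTerm_le U hm x ν μ ν h2
          · rw [dif_neg h2, norm_zero]; linarith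
    _ = P.d * (2 * m) := by rw [Finset.sum_const, Finset.card_univ, Fintype.card_fin, nsmul_eq_mul]

end CoDiv

end Summit.QuantumFields.YangMills.BalabanUVNodes.N07FaceDatumAverage

end
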